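import Summits.QuantumAdvantage.QuantumAdvantage.Theorems.OddPrimeWalkOddLocalCells
import Summits.QuantumAdvantage.QuantumAdvantage.Theses.OddPrimeWalk

/-!
# Item stmt-QuantumAdvantage-23991 `LocalTwoThirdsLaw` — part 4/4: the per-window loss, the law, and the item (route OddPrimeWalk, support, rank 9)

AUTHORED AND PROVED BY THE PLANNER SEAT qa-qnc0-p2 g29 (`HOME/qa-qnc0-p2/line29/LocalTwoThirds23991.lean`, 1082 lines, farm
rc 0 / 0 sorry); landed verbatim (split for the 400-line rule, one-line docstrings added) by qn-prover-3 g18, ask P2-29g.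

THEOREM (`oddPrimeWalk_localTwoThirdsLaw`, = planner's `OddLocal.localTwoThirdsLaw`): a u-walk strategy whose cut `g` reads only the
bits in `[g−w, g+w)` wins `ringWinU c` on at most `(2/3 + 32·2^(-m₀))·2ⁿ` inputs whenever `6w + 4m₀ ≤ n` (no degree hypothesis).
WHAT THIS IS NOT: the computational core `core4_le` (part `OddPrimeWalkOddLocalCore`, `native_decide`) is in the axiom closure;
separation NOT moved.
-/

namespace Summit.QuantumAdvantage.AdviceFreeQNC0.OddLocal

open Finset Literature.Computability.MetaComplexity

variable {n : ℕ}

/-! ### arithmetic -/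

/-- Auxiliary `prod_one_sub_ge` of the local two-thirds law (planner qa-qnc0-p2 g29, `LocalTwoThirds23991.lean`, verbatim). -/
theorem prod_one_sub_ge (x : Fin 4 → ℝ) (h0 : ∀ j, 0 ≤ x j) (h1 : ∀ j, x j ≤ 1) :
    1 - ∑ j, x j ≤ ∏ j, (1 - x j) := by
  rw [Fin.sum_univ_four, Fin.prod_univ_four]
  have a0 := h0 0; have a1 := h0 1; have a2 := h0 2; have a3 := h0 3
  have b0 := h1 0; have b1 := h1 1; have b2 := h1 2; have b3 := h1 3
  have s2 : 1 - x 0 - x 1 ≤ (1 - x 0) * (1 - x 1) := by nlinarith [mul_nonneg a0 a1]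
  have p2 : 0 ≤ (1 - x 0) * (1 - x 1) := mul_nonneg (by linarith) (by linarith)
  have s3 : 1 - x 0 - x 1 - x 2 ≤ (1 - x 0) * (1 - x 1) * (1 - x 2) := by
    nlinarith [mul_nonneg (sub_nonneg.2 s2) (sub_nonneg.2 b2), mul_nonneg (add_nonneg a0 a1) a2]
  have p3 : 0 ≤ (1 - x 0) * (1 - x 1) * (1 - x 2) := mul_nonneg p2 (by linarith)
  nlinarith [mul_nonneg (sub_nonneg.2 s3) (sub_nonneg.2 b3), mul_nonneg (add_nonneg (add_nonneg a0 a1) a2) a3]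

/-- per-window loss, relative to the fibre: among the inputs with window word `ω`, at least the fraction
`(1 − 8·2^{−m₀})/3` is lost. -/
theorem loss_window (m₀ w c : ℕ) (hn : 6 * w + 4 * m₀ ≤ n) (hm : 3 ≤ m₀)
    (y : Fin (n + 1) → (Fin n → Bool) → Bool) (hy : Radius y w) (ω : Fin n → Bool) :
    (1 - 8 * (2 : ℝ)⁻¹ ^ m₀) / 3 * ((univ.filter fun u : Fin n → Bool => wproj m₀ w u = ω).card : ℝ) ≤
      ((univ.filter fun u : Fin n → Bool => ringWinU c y u = false ∧ wproj m₀ w u = ω).card : ℝ) := by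
  classical
  by_cases hω : ∀ l : Fin n, ¬ inWindow m₀ w l.val → ω l = false
  swap
  · -- empty fibre
    have he : (univ.filter fun u : Fin n → Bool => wproj m₀ w u = ω) = ∅ := by
      rw [Finset.filter_eq_empty_iff]
      intro u _ hu
      apply hω
      intro l hl
      have := congrFun hu l
      simp only [wproj, hl, if_false] at this
      exact this.symm
    rw [he, Finset.card_empty, Nat.cast_zero, mul_zero]
    exact Nat.cast_nonneg _
  -- notation
  set L : Fin 4 → ℕ := fun j => (Free m₀ w j (n := n)).card with hL
  have hLm : ∀ j, m₀ ≤ L j := fun j => free_ge m₀ w hn j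
  set X : Fin 4 → ℝ := fun j => (2 : ℝ) ^ (L j) with hX
  have hX0 : ∀ j, (2 : ℝ) ^ m₀ ≤ X j := fun j => pow_le_pow_right₀ (by norm_num) (hLm j)
  have h4 : (4 : ℝ) ≤ (2 : ℝ) ^ m₀ := by
    calc (4 : ℝ) = 2 ^ 2 := by norm_num
      _ ≤ 2 ^ m₀ := pow_le_pow_right₀ (by norm_num) (by omega)
  -- class sizes
  have hcls : ∀ j a, (X j - 2) / 3 ≤ ((pats m₀ w ω j a).card : ℝ) := by
    intro j a
    have h := class_ge m₀ w ω hω j a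
    have h' : ((2 ^ (L j) : ℕ) : ℝ) ≤ ((3 * (pats m₀ w ω j a).card + 2 : ℕ) : ℝ) := by exact_mod_cast h
    push_cast at h'
    simp only [hX]
    linarith
  have hne : ∀ j a, (pats m₀ w ω j a).Nonempty := by
    intro j a
    rw [← Finset.card_pos]
    have h := hcls j a
    have hx := (h4.trans (hX0 j))
    have : (0 : ℝ) < ((pats m₀ w ω j a).card : ℝ) := by linarith
    exact_mod_cast this
  -- Q := Π_j (X_j - 2)/3 ≤ #cell a
  set Q : ℝ := ∏ j : Fin 4, (X j - 2) / 3 with hQ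
  have hQpos : 0 < Q := Finset.prod_pos fun j _ => by
    have := (h4.trans (hX0 j)); linarith
  have hcell : ∀ a : Fin 4 → Fin 3, Q ≤ ∏ j, ((pats m₀ w ω j (a j)).card : ℝ) := fun a =>
    Finset.prod_le_prod (fun j _ => by have := (h4.trans (hX0 j)); linarith) fun j _ => hcls j (a j)
  have hcellcard : ∀ a : Fin 4 → Fin 3, ((cell m₀ w ω a).card : ℝ) = ∏ j, ((pats m₀ w ω j (a j)).card : ℝ) := by
    intro a
    rw [cell, Fintype.card_piFinset, Nat.cast_prod]
  -- averaged score
  have havg := cells_average m₀ w c hn y hy ω hne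
  -- N_a := lost in cell a;  Σ_a N_a / #cell a ≥ 27
  have hsplit : ∀ a : Fin 4 → Fin 3,
      (((cell m₀ w ω a).filter fun x => ringWinU c y (G m₀ w x) = true).card : ℝ) +
        (((cell m₀ w ω a).filter fun x => ringWinU c y (G m₀ w x) = false).card : ℝ) =
        (cell m₀ w ω a).card := by
    intro a
    have h := Finset.card_filter_add_card_filter_not (s := cell m₀ w ω a)
      (p := fun x => ringWinU c y (G m₀ w x) = true)
    have e : ((cell m₀ w ω a).filter fun x => ¬ ringWinU c y (G m₀ w x) = true) =
        (cell m₀ w ω a).filter fun x => ringWinU c y (G m₀ w x) = false := by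
      ext x; simp
    rw [e] at h
    exact_mod_cast h
  have h27 : (27 : ℝ) ≤ ∑ a : Fin 4 → Fin 3,
      (((cell m₀ w ω a).filter fun x => ringWinU c y (G m₀ w x) = false).card : ℝ) /
        ∏ j, ((pats m₀ w ω j (a j)).card : ℝ) := by
    have hone : ∀ a : Fin 4 → Fin 3,
        (((cell m₀ w ω a).filter fun x => ringWinU c y (G m₀ w x) = false).card : ℝ) /
          ∏ j, ((pats m₀ w ω j (a j)).card : ℝ) =
        1 - (((cell m₀ w ω a).filter fun x => ringWinU c y (G m₀ w x) = true).card : ℝ) /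
          ∏ j, ((pats m₀ w ω j (a j)).card : ℝ) := by
      intro a
      have hpos : (0 : ℝ) < ∏ j, ((pats m₀ w ω j (a j)).card : ℝ) := lt_of_lt_of_le hQpos (hcell a)
      rw [eq_sub_iff_add_eq, ← add_div, add_comm, hsplit a, hcellcard a, div_self (ne_of_gt hpos)]
    rw [Finset.sum_congr rfl fun a _ => hone a, Finset.sum_sub_distrib, Finset.sum_const, Finset.card_univ]
    have hc : (Fintype.card (Fin 4 → Fin 3)) = 81 := by simp
    rw [hc]
    norm_num
    linarith [havg]
  -- Σ_a N_a ≥ 27 Q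
  have hN : 27 * Q ≤ ∑ a : Fin 4 → Fin 3,
      (((cell m₀ w ω a).filter fun x => ringWinU c y (G m₀ w x) = false).card : ℝ) := by
    have hle : ∀ a : Fin 4 → Fin 3,
        (((cell m₀ w ω a).filter fun x => ringWinU c y (G m₀ w x) = false).card : ℝ) /
          ∏ j, ((pats m₀ w ω j (a j)).card : ℝ) ≤
        (((cell m₀ w ω a).filter fun x => ringWinU c y (G m₀ w x) = false).card : ℝ) / Q := fun a =>
      div_le_div_of_nonneg_left (Nat.cast_nonneg _) hQpos (hcell a)
    have h := h27.trans (Finset.sum_le_sum fun a _ => hle a)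
    rw [← Finset.sum_div, le_div_iff₀ hQpos] at h
    linarith
  -- losses in the fibre ≥ Σ_a N_a
  have hinj := cells_inject m₀ w c y ω hω
  have hinjR : (∑ a : Fin 4 → Fin 3,
      (((cell m₀ w ω a).filter fun x => ringWinU c y (G m₀ w x) = false).card : ℝ)) ≤
      ((univ.filter fun u : Fin n → Bool => ringWinU c y u = false ∧ wproj m₀ w u = ω).card : ℝ) := by
    exact_mod_cast hinj
  -- the fibre has ≤ Π_j X_j inputs
  have hF : ((univ.filter fun u : Fin n → Bool => wproj m₀ w u = ω).card : ℝ) ≤ ∏ j, X j := by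
    have h := fibre_le m₀ w ω (n := n)
    have h' : ((univ.filter fun u : Fin n → Bool => wproj m₀ w u = ω).card : ℝ) ≤
        ((2 ^ (∑ j : Fin 4, (Free m₀ w j (n := n)).card) : ℕ) : ℝ) := by exact_mod_cast h
    rw [Nat.cast_pow, ← Finset.prod_pow_eq_pow_sum] at h'
    push_cast at h'
    simpa [hX, hL] using h'
  -- (1 - 8·2^{-m₀}) Π X ≤ Π (X - 2) = 81 Q
  have hprod : (1 - 8 * (2 : ℝ)⁻¹ ^ m₀) * ∏ j, X j ≤ 81 * Q := by
    have hx : ∀ j, 0 < X j := fun j => lt_of_lt_of_le (by linarith [h4]) (hX0 j)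
    have e1 : (81 : ℝ) * Q = (∏ j, X j) * ∏ j, (1 - 2 / X j) := by
      rw [hQ, ← Finset.prod_mul_distrib]
      have : (81 : ℝ) = ∏ _j : Fin 4, (3 : ℝ) := by simp; norm_num
      rw [this, ← Finset.prod_mul_distrib]
      refine Finset.prod_congr rfl fun j _ => ?_
      have hxj : X j ≠ 0 := (hx j).ne'
      field_simp
    rw [e1, mul_comm]
    refine mul_le_mul_of_nonneg_left ?_ (Finset.prod_nonneg fun j _ => (hx j).le)
    have hb := prod_one_sub_ge (fun j => 2 / X j) (fun j => div_nonneg (by norm_num) (hx j).le)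
      (fun j => by rw [div_le_one (hx j)]; linarith [h4, hX0 j])
    refine le_trans ?_ hb
    have hs : ∑ j : Fin 4, 2 / X j ≤ 8 * (2 : ℝ)⁻¹ ^ m₀ := by
      have hj : ∀ j : Fin 4, 2 / X j ≤ 2 * (2 : ℝ)⁻¹ ^ m₀ := by
        intro j
        rw [inv_pow, ← div_eq_mul_inv]
        exact div_le_div_of_nonneg_left (by norm_num) (by positivity) (hX0 j)
      calc ∑ j : Fin 4, 2 / X j ≤ ∑ _j : Fin 4, 2 * (2 : ℝ)⁻¹ ^ m₀ := Finset.sum_le_sum fun j _ => hj j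
        _ = 8 * (2 : ℝ)⁻¹ ^ m₀ := by simp; ring
    linarith
  -- assemble
  calc (1 - 8 * (2 : ℝ)⁻¹ ^ m₀) / 3 * ((univ.filter fun u : Fin n → Bool => wproj m₀ w u = ω).card : ℝ)
      ≤ (1 - 8 * (2 : ℝ)⁻¹ ^ m₀) / 3 * ∏ j, X j := by
        refine mul_le_mul_of_nonneg_left hF (div_nonneg ?_ (by norm_num))
        have : 8 * (2 : ℝ)⁻¹ ^ m₀ ≤ 1 := by
          rw [inv_pow]
          have : (8 : ℝ) ≤ 2 ^ m₀ := by
            calc (8 : ℝ) = 2 ^ 3 := by norm_num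
              _ ≤ 2 ^ m₀ := pow_le_pow_right₀ (by norm_num) (by omega)
          rw [mul_inv_le_iff₀ (by positivity)]
          linarith
        linarith
    _ = ((1 - 8 * (2 : ℝ)⁻¹ ^ m₀) * ∏ j, X j) / 3 := by ring
    _ ≤ 81 * Q / 3 := by gcongr
    _ = 27 * Q := by ring
    _ ≤ _ := hN.trans hinjR

/-- fibrewise count by the window word. -/
theorem card_eq_sum_wproj (m₀ w : ℕ) (Q : (Fin n → Bool) → Prop) [DecidablePred Q] :
    (univ.filter Q).card = ∑ ω : Fin n → Bool, (univ.filter fun u : Fin n → Bool => Q u ∧ wproj m₀ w u = ω).card := by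
  rw [card_eq_sum_card_fiberwise (f := wproj m₀ w) (t := univ) (fun _ _ => mem_coe.mpr (mem_univ _))]
  refine Finset.sum_congr rfl fun ω _ => ?_
  rw [filter_filter]

/-- **`LocalTwoThirdsLaw`** (stmt-QuantumAdvantage-23991, verbatim) from the stubs. -/
theorem localTwoThirdsLaw : ∀ m₀ n w c : ℕ, ∀ y : Fin (n + 1) → (Fin n → Bool) → Bool,
    6 * w + 4 * m₀ ≤ n →
    (∀ g : Fin (n + 1), ∀ u u' : Fin n → Bool,
      (∀ i : Fin n, g.val ≤ i.val + w → i.val < g.val + w → u i = u' i) → y g u = y g u') →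
    ((Finset.univ.filter fun u : Fin n → Bool => AdviceFreeQNC0.ringWinU c y u = true).card : ℝ)
      ≤ (2 / 3 + 32 * (2 : ℝ)⁻¹ ^ m₀) * (2 : ℝ) ^ n := by
  intro m₀ n w c y hn hy
  have hX0 : (0 : ℝ) < (2 : ℝ) ^ n := by positivity
  have hWL : ((univ.filter fun u : Fin n → Bool => ringWinU c y u = true).card : ℝ) +
      ((univ.filter fun u : Fin n → Bool => ringWinU c y u = false).card : ℝ) = (2 : ℝ) ^ n := by
    have h := Finset.card_filter_add_card_filter_not (s := (univ : Finset (Fin n → Bool)))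
      (p := fun u : Fin n → Bool => ringWinU c y u = true)
    rw [Finset.card_univ, Fintype.card_fun, Fintype.card_bool, Fintype.card_fin] at h
    have e : (univ.filter fun u : Fin n → Bool => ¬ ringWinU c y u = true) =
        univ.filter fun u : Fin n → Bool => ringWinU c y u = false := by
      ext u; simp
    rw [e] at h
    exact_mod_cast h
  -- small m₀: the bound is trivial
  by_cases hm : m₀ ≤ 5
  · have h32 : (1 : ℝ) ≤ 32 * (2 : ℝ)⁻¹ ^ m₀ := by
      have h5 : (2 : ℝ)⁻¹ ^ 5 ≤ (2 : ℝ)⁻¹ ^ m₀ :=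
        pow_le_pow_of_le_one (by norm_num) (by norm_num) hm
      nlinarith [h5]
    have hcard : ((univ.filter fun u : Fin n → Bool => ringWinU c y u = true).card : ℝ) ≤ (2 : ℝ) ^ n := by
      have := (Nat.cast_nonneg _ : (0 : ℝ) ≤ ((univ.filter fun u : Fin n → Bool => ringWinU c y u = false).card : ℝ))
      linarith
    nlinarith [hcard, h32, hX0]
  -- the real case
  have hm2 : 3 ≤ m₀ := by omega
  set κ : ℝ := (1 - 8 * (2 : ℝ)⁻¹ ^ m₀) / 3 with hκ
  have hL : ((univ.filter fun u : Fin n → Bool => ringWinU c y u = false).card : ℝ) =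
      ∑ ω : Fin n → Bool, ((univ.filter fun u : Fin n → Bool =>
        ringWinU c y u = false ∧ wproj m₀ w u = ω).card : ℝ) := by
    exact_mod_cast card_eq_sum_wproj m₀ w (fun u : Fin n → Bool => ringWinU c y u = false)
  have hA : ((2 : ℝ) ^ n) = ∑ ω : Fin n → Bool, ((univ.filter fun u : Fin n → Bool =>
        wproj m₀ w u = ω).card : ℝ) := by
    have h := card_eq_sum_card_fiberwise (f := wproj m₀ w) (s := (univ : Finset (Fin n → Bool)))
      (t := univ) (fun _ _ => mem_coe.mpr (mem_univ _))
    rw [Finset.card_univ, Fintype.card_fun, Fintype.card_bool, Fintype.card_fin] at h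
    exact_mod_cast h
  have hsum : κ * (2 : ℝ) ^ n ≤ ((univ.filter fun u : Fin n → Bool => ringWinU c y u = false).card : ℝ) := by
    rw [hL, hA, Finset.mul_sum]
    exact Finset.sum_le_sum fun ω _ => loss_window m₀ w c hn hm2 y hy ω
  have hq : (0 : ℝ) ≤ (2 : ℝ)⁻¹ ^ m₀ := by positivity
  rw [hκ] at hsum
  nlinarith [hsum, hWL, hX0, hq]

end Summit.QuantumAdvantage.AdviceFreeQNC0.OddLocal


namespace Summit.QuantumAdvantage.QuantumAdvantage.Theorems

set_option linter.dupNamespace false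

/-- **Item stmt-QuantumAdvantage-23991 `LocalTwoThirdsLaw` (route OddPrimeWalk, support, rank 9; planner qa-qnc0-p2 g28/g29 ROUND-28
THM 1⁺; proof by the planner seat, landed by qn-prover-3 g18).**  Reading radius `w`, `6w + 4m₀ ≤ n` ⇒ `#WIN ≤ (2/3 + 32·2^{-m₀})·2ⁿ`. -/
theorem oddPrimeWalk_localTwoThirdsLaw : Summit.QuantumAdvantage.QuantumAdvantage.Theses.OddPrimeWalk.LocalTwoThirdsLaw :=
  Summit.QuantumAdvantage.AdviceFreeQNC0.OddLocal.localTwoThirdsLaw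

end Summit.QuantumAdvantage.QuantumAdvantage.Theorems
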